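import Mathlib.RingTheory.IntegralClosure.IntegrallyClosed
import Mathlib.RingTheory.IntegralClosure.Algebra.Basic
import Mathlib.RingTheory.Ideal.AssociatedPrime.Basic
import Mathlib.RingTheory.Ideal.KrullsHeightTheorem
import Mathlib.RingTheory.Localization.FractionRing
import HarnessLib

/-!
# [OURS · L1 W4.5(b) · EL♮] (V) NO-PURE-NOSE spine, F-(V)b DISCHARGED: in a Noetherian NORMAL domain the associated primes of a
# principal ideal have height one (S₂ for principal ideals — memo step (6) «S̃^ν normal ⇒ (S̃^ν)_s = S̃^ν/ϖ has no embedded components»)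
# (crux `EquisingularLiftNat` = stmt-ResolutionOfSingularities-20038; PARENT ≥ 4 band / kill test #50 K5-BMY, PURE column)

HONEST FRAMING. OURS (cell res-hironaka, crux chain w45b, slot W4.5(b)); NOT a statement of any manuscript; AI-written, AI review is
weaker than expert review. Helper `--supports stmt-ResolutionOfSingularities-20038 --as helper`. Object «(V) NO-PURE-NOSE» (res-L1-w45b-plan-1
DESK 2026-08-27T21:18:40Z) for res-D-brk-4 g9; this file DISCHARGES the NEED-FACT F-(V)b stated in `…NatNoPureNoseSpine` (the desk's item (b)
«R normal domain, ϖ ∈ R nonzero nonunit ⇒ R ⧸ ϖ has no embedded primes»), in the honest form the library allows and the memo uses: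

* `height_eq_one_of_mem_associatedPrimes_quotient_span_singleton` — `R` a Noetherian integrally closed domain, `a ≠ 0`: every associated
  prime `𝔔` of the `R`-module `R ⧸ (a)` has `height 𝔔 = 1`. Hence `R ⧸ (a)` has no EMBEDDED associated primes (all are minimal over `(a)`,
  `mem_minimalPrimes_of_mem_associatedPrimes_quotient_span_singleton`), i.e. `(S̃^ν)_s` is `S₁` in the memo's step (6).

PROOF (the classical one, [Matsumura1987, Thm. 11.5 (ii)⇒ … / §17], [Kaplansky, Thm. 104]; no Krull-domain theory needed): `𝔔 = ((a) : x)` for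
some `x ∉ (a)`; put `y = x/a ∈ Frac R`, so `𝔔·y ⊆ R`. If `𝔔·y ⊆ 𝔔` then `y` stabilises the nonzero finitely generated `R`-submodule `𝔔 ⊆ Frac R`,
hence is integral over `R` (determinant trick, Mathlib `isIntegral_of_smul_mem_submodule`), hence in `R` (integrally closed) — so `x ∈ (a)`,
absurd. Otherwise some `r ∈ 𝔔` has `s := r·y ∈ R ∖ 𝔔`; then for every `q ∈ 𝔔`, `s·q ∈ (r)` (`s q a = q r x = r · (q x)` and `q x ∈ (a)`), so
every prime between `(r)` and `𝔔` contains `𝔔`: `𝔔` is minimal over the principal ideal `(r)`, and Krull's principal ideal theorem (Mathlib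
`Ideal.height_le_one_of_isPrincipal_of_mem_minimalPrimes`) gives `height 𝔔 ≤ 1`; `𝔔 ∋ a ≠ 0` gives `height 𝔔 ≠ 0`.

References: H. Matsumura, *Commutative Ring Theory* (1986), Thm. 11.5 and §17 (Serre's conditions) [Matsumura1987]; I. Kaplansky,
*Commutative Rings*, Thm. 104; [StacksProject, Tag 031T, 0AVL].
-/

set_option linter.dupNamespace false -- mandated namespace `Summit.<Summit>.<Problem>` of this single-conjunct summit

noncomputable section

universe u

namespace Summit.ResolutionOfSingularities.ResolutionOfSingularities.Cruxes.EquisingularLiftNat.Sections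

namespace NoPureNose

open Submodule

/-- Associated primes of `R ⧸ (a)` in colon form: `𝔔` is prime and `𝔔 = {r | r·x ∈ (a)}` for some `x : R`. [folklore] -/
theorem exists_eq_colon_of_mem_associatedPrimes_quotient {R : Type u} [CommRing R] [IsNoetherianRing R] {a : R} {𝔔 : Ideal R}
    (h𝔔 : 𝔔 ∈ associatedPrimes R (R ⧸ Ideal.span {a})) :
    𝔔.IsPrime ∧ ∃ x : R, ∀ r : R, r ∈ 𝔔 ↔ r * x ∈ Ideal.span {a} := by
  rw [AssociatedPrimes.mem_iff, isAssociatedPrime_iff] at h𝔔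
  obtain ⟨hprime, x, hx⟩ := h𝔔
  obtain ⟨x₀, rfl⟩ := Ideal.Quotient.mk_surjective x
  refine ⟨hprime, x₀, fun r => ?_⟩
  rw [hx, mem_colon_singleton, mem_bot, Algebra.smul_def, Ideal.Quotient.algebraMap_eq, ← map_mul,
    Ideal.Quotient.eq_zero_iff_mem]

/-- **F-(V)b — in a Noetherian integrally closed domain, the associated primes of a nonzero principal ideal have height one.**
[cite: Matsumura1987, Thm. 11.5] -/
theorem height_eq_one_of_mem_associatedPrimes_quotient_span_singleton {R : Type u} [CommRing R] [IsDomain R] [IsNoetherianRing R]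
    [IsIntegrallyClosed R] {a : R} (ha : a ≠ 0) {𝔔 : Ideal R} (h𝔔 : 𝔔 ∈ associatedPrimes R (R ⧸ Ideal.span {a})) :
    𝔔.height = 1 := by
  classical
  obtain ⟨hprime, x, hx⟩ := exists_eq_colon_of_mem_associatedPrimes_quotient h𝔔
  haveI := hprime
  -- `a ∈ 𝔔`, so `𝔔 ≠ ⊥` and `height 𝔔 ≠ 0`
  have ha𝔔 : a ∈ 𝔔 := (hx a).mpr (Ideal.mem_span_singleton'.mpr ⟨x, by ring⟩)
  have hne : 𝔔.height ≠ 0 := by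
    rw [Ne, Ideal.height_eq_zero_iff_eq_bot]
    intro h
    exact ha (by simpa [h] using ha𝔔)
  -- `x ∉ (a)` (else `𝔔 = ⊤`)
  have hxa : x ∉ Ideal.span {a} := by
    intro hmem
    apply hprime.ne_top
    rw [Ideal.eq_top_iff_one, hx, one_mul]
    exact hmem
  -- the multipliers: for `r ∈ 𝔔`, `r x = s a`
  have hcol : ∀ r ∈ 𝔔, ∃ s : R, s * a = r * x := fun r hr => Ideal.mem_span_singleton'.mp ((hx r).mp hr)
  suffices h1 : 𝔔.height ≤ 1 by
    exact le_antisymm h1 (Order.one_le_iff_ne_zero.mpr hne)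
  by_cases hB : ∃ r ∈ 𝔔, ∃ s : R, s * a = r * x ∧ s ∉ 𝔔
  · -- Case B: `𝔔` is minimal over the principal ideal `(r)`
    obtain ⟨r, hr, s, hs, hs𝔔⟩ := hB
    have hmin : 𝔔 ∈ (Ideal.span {r}).minimalPrimes := by
      refine ⟨⟨hprime, (Ideal.span_singleton_le_iff_mem _).mpr hr⟩, ?_⟩
      rintro P ⟨hP, hrP⟩ hP𝔔 q hq
      obtain ⟨t, ht⟩ := hcol q hq
      have hsq : s * q ∈ Ideal.span ({r} : Set R) := by
        refine Ideal.mem_span_singleton'.mpr ⟨t, ?_⟩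
        have e : (s * q) * a = (t * r) * a := by
          calc (s * q) * a = q * (s * a) := by ring
            _ = q * (r * x) := by rw [hs]
            _ = r * (q * x) := by ring
            _ = r * (t * a) := by rw [ht]
            _ = (t * r) * a := by ring
        exact (mul_right_cancel₀ ha e).symm
      have hsqP : s * q ∈ P := hrP hsq
      exact (hP.mem_or_mem hsqP).resolve_left (fun hsP => hs𝔔 (hP𝔔 hsP))
    exact Ideal.height_le_one_of_isPrincipal_of_mem_minimalPrimes (Ideal.span {r}) 𝔔 hmin
  · -- Case A: `y = x/a` stabilises `𝔔 ⊆ Frac R`, hence is integral, hence in `R`: `x ∈ (a)`, absurd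
    exfalso
    push Not at hB
    -- hB : ∀ r ∈ 𝔔, ∀ s, s * a = r * x → s ∈ 𝔔
    let K := FractionRing R
    have haK : algebraMap R K a ≠ 0 := fun h => ha ((IsFractionRing.injective R K) (by rw [h, map_zero]))
    let y : K := algebraMap R K x * (algebraMap R K a)⁻¹
    let N : Submodule R K := Submodule.map (Algebra.linearMap R K) (𝔔 : Submodule R R)
    have hNmem : ∀ n : K, n ∈ N ↔ ∃ r ∈ 𝔔, algebraMap R K r = n := fun n => by
      simp only [N, Submodule.mem_map, Algebra.linearMap_apply]
    have hNfg : N.FG := (IsNoetherian.noetherian (𝔔 : Submodule R R)).map _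
    have hNne : N ≠ ⊥ := by
      intro h
      have : algebraMap R K a ∈ N := (hNmem _).mpr ⟨a, ha𝔔, rfl⟩
      rw [h, mem_bot] at this
      exact haK this
    have hstab : ∀ n ∈ N, y • n ∈ N := by
      intro n hn
      obtain ⟨r, hr, rfl⟩ := (hNmem n).mp hn
      obtain ⟨s, hs⟩ := hcol r hr
      have hs𝔔 : s ∈ 𝔔 := hB r hr s hs
      refine (hNmem _).mpr ⟨s, hs𝔔, ?_⟩
      have e : algebraMap R K s * algebraMap R K a = algebraMap R K r * algebraMap R K x := by
        rw [← map_mul, ← map_mul, hs]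
      show algebraMap R K s = algebraMap R K x * (algebraMap R K a)⁻¹ * algebraMap R K r
      calc algebraMap R K s = algebraMap R K s * algebraMap R K a * (algebraMap R K a)⁻¹ := by
            rw [mul_assoc, mul_inv_cancel₀ haK, mul_one]
        _ = algebraMap R K r * algebraMap R K x * (algebraMap R K a)⁻¹ := by rw [e]
        _ = algebraMap R K x * (algebraMap R K a)⁻¹ * algebraMap R K r := by ring
    have hint : IsIntegral R y := isIntegral_of_smul_mem_submodule N hNne hNfg y hstab
    obtain ⟨z, hz⟩ := IsIntegrallyClosed.isIntegral_iff.mp hint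
    apply hxa
    refine Ideal.mem_span_singleton'.mpr ⟨z, IsFractionRing.injective R K ?_⟩
    rw [map_mul, hz]
    show algebraMap R K x * (algebraMap R K a)⁻¹ * algebraMap R K a = algebraMap R K x
    rw [mul_assoc, inv_mul_cancel₀ haK, mul_one]

/-- Hence **`R ⧸ (a)` has no embedded primes**: every associated prime of `R ⧸ (a)` is minimal over `(a)` (condition S₁ for the special
fibre `S̃^ν ⧸ ϖ` of a normal `S̃^ν`, memo step (6)). [cite: Matsumura1987, Thm. 11.5 and §17] -/
theorem mem_minimalPrimes_of_mem_associatedPrimes_quotient_span_singleton {R : Type u} [CommRing R] [IsDomain R] [IsNoetherianRing R]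
    [IsIntegrallyClosed R] {a : R} (ha : a ≠ 0) {𝔔 : Ideal R} (h𝔔 : 𝔔 ∈ associatedPrimes R (R ⧸ Ideal.span {a})) :
    𝔔 ∈ (Ideal.span {a}).minimalPrimes := by
  obtain ⟨hprime, x, hx⟩ := exists_eq_colon_of_mem_associatedPrimes_quotient h𝔔
  haveI := hprime
  have ha𝔔 : a ∈ 𝔔 := (hx a).mpr (Ideal.mem_span_singleton'.mpr ⟨x, by ring⟩)
  have h1 := height_eq_one_of_mem_associatedPrimes_quotient_span_singleton ha h𝔔
  refine ⟨⟨hprime, (Ideal.span_singleton_le_iff_mem _).mpr ha𝔔⟩, ?_⟩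
  rintro P ⟨hP, haP⟩ hP𝔔
  -- `P ⊆ 𝔔`, both primes, `P ≠ ⊥` (contains `a`), `height 𝔔 = 1` ⇒ `P = 𝔔`
  haveI := hP
  by_contra hne
  have hlt : P < 𝔔 := lt_of_le_of_ne hP𝔔 (fun h => hne (h ▸ le_rfl))
  have hP0 : P.height ≠ 0 := by
    rw [Ne, Ideal.height_eq_zero_iff_eq_bot]
    intro h
    have : a ∈ P := haP (Ideal.mem_span_singleton_self a)
    rw [h] at this
    exact ha this
  haveI : 𝔔.FiniteHeight := ⟨Or.inr (by rw [h1]; exact ENat.one_ne_top)⟩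
  have h2 : P.height < 𝔔.height := Ideal.height_strict_mono_of_isPrime_of_isPrime hlt
  rw [h1, Order.lt_one_iff] at h2
  exact hP0 h2

end NoPureNose

end Summit.ResolutionOfSingularities.ResolutionOfSingularities.Cruxes.EquisingularLiftNat.Sections
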